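import Literature.AlgebraicGeometry.Frobenioids.PerfFactorialCoprime
import Literature.AlgebraicGeometry.Frobenioids.PerfFactorialWeak
import HarnessLib

/-!
# Frobenioids I, Proposition 4.1 (iii) for WEAKLY perf-factorial monoids: disjoint supports, the
# monoid criterion and "elements with disjoint supports are determined by their difference"

Mochizuki, *The geometry of Frobenioids I: the general theory*, Kyushu J. Math. **62** (2008),
Definition 2.4 (i)(c)(d) (kurims pp. 47–48) and Proposition 4.1 (iii) (pp. 76–77)
[cite: MochizukiFrdI2008, Prop. 4.1 (iii) p.76]; used in [EtTh] Definition 4.1 (i), PDF p.86: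
"`Div(s')`, `Div(s'')` have disjoint supports [cf. [FrdI], Proposition 4.1, (iii)]. [Thus, `Div(s')`,
`Div(s'')` are uniquely determined by `f`.]"

Weak-hypothesis twin of `PerfFactorialSupports.lean` (Prop. 4.1 (iii) part, seat abc-iut-L1-t14) and
`PerfFactorialCoprime.lean` (seat abc-iut-L6-t12): the monoid `M` is only WEAKLY perf-factorial
(`IsPerfFactorialWeak` = (a)(b)(c) of Def. 2.4 (i) + (d_ord) + (d_res), `PerfFactorialWeak.lean`; the
abc-iut cell's repair of finding F-L2d2-1: at tempered coverings with infinitely many special-fibre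
components — `Ÿ`, `Z_∞`, the objects of [EtTh] §§4–5 — the printed clause (d) fails for
`Φ₀(Y^log) ⊇ ∏_j ℤ_{≥0}`).  Every proof below is the strong proof VERBATIM with the hypothesis
re-targeted: none of them uses clause (d) itself, only (c) (injectivity of the factorization
homomorphism, image in `∏_𝔮 M^pf_𝔮`), (b) (each `M_𝔭` monoprime, so divisibility in `M_𝔭` is total)
and the weak splitting `IsPerfFactorialWeak.exists_split` ((d_res)) / `dvd_of_factorMap_mul_eq` ((d_ord)).

* `IsPerfFactorialWeak.forall_common_dvd_eq_one_iff_disjoint_supp` — Prop. 4.1 (iii), criterion: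
  "every `x` with `x ≤ a`, `x ≤ b` is `0`" iff `a`, `b` have disjoint supports;
* `IsPerfFactorialWeak.mul_dvd_of_forall_common_dvd_eq_one` — Prop. 4.1 (iii), displayed property:
  then "`a + b ≤ c` iff `a ≤ c`, `b ≤ c`";
* `IsPerfFactorialWeak.eq_of_mul_eq_mul_of_forall_common_dvd_eq_one` — [EtTh] Def. 4.1 (i)'s bracket:
  pairs with disjoint supports and the same difference coincide.

Consumer: [EtTh] Prop. 4.2 (i)(ii) at the canonical model of the §4 setting over the weak vocabulary
(`Discharge/Sec4Prop42Weak.lean`).  Theorems only; multiplicative notation as in `Monoids.lean`.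
HONEST FRAMING: classical monoid algebra; nothing here bears on [IUTchIII] Cor. 3.12.
-/

namespace Literature.AlgebraicGeometry.Frobenioids

open Function

universe u

variable {M : Type u} [CommMonoid M]

namespace IsPerfFactorialWeak

/-! ### Coordinates of primary elements (Def. 2.4 (i)(b)(c)), weak hypothesis -/

/-- In a weakly perf-factorial monoid the `𝔮`-coordinate of a primary element `q ∈ 𝔮` is non-zero
(the factorization homomorphism is injective and `q ≠ 0`). [cite: MochizukiFrdI2008, Def. 2.4(i) p.47] -/
theorem factorMap_apply_ne_one (h : IsPerfFactorialWeak M) {𝔮 : Primes (Perfection M)}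
    {q : Perfection M} (hq : q ∈ 𝔮.carrier) : factorMap M q 𝔮 ≠ 1 := by
  intro h1
  obtain ⟨hprim, hcls⟩ := hq
  apply hprim.1
  apply h.factorMap_injective
  rw [h.factorMap_one]
  funext 𝔮'
  by_cases e : 𝔮' = 𝔮
  · rw [e, h1]; rfl
  · rw [factorMap_apply_of_ne M ⟨hprim, hcls⟩ e]; rfl

/-- No element of `𝔮` divides an element with zero `𝔮`-coordinate (weak hypothesis).
[cite: MochizukiFrdI2008, Def. 2.4(i) p.47] -/
theorem not_dvd_of_factorMap_apply_eq_one (h : IsPerfFactorialWeak M)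
    {𝔮 : Primes (Perfection M)} {q y₂ : Perfection M} (hq : q ∈ 𝔮.carrier)
    (hy₂ : factorMap M y₂ 𝔮 = 1) : ¬ q ∣ y₂ := by
  intro hdvd
  obtain ⟨c, hc⟩ := map_dvd h.factorHom hdvd
  have h1 : factorMap M q 𝔮 ∣ 1 := ⟨c 𝔮, by
    have e := congrFun hc 𝔮
    rw [h.factorHom_apply, hy₂] at e
    exact e⟩
  exact h.factorMap_apply_ne_one hq ((isSharp_realification _).eq_one_of_isUnit _ (isUnit_of_dvd_one h1))

/-- An element supported at the single prime `𝔮` is `≼ p` for every `p ∈ 𝔮` (its `𝔮`-coordinate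
lies in `M^pf_𝔮`, all of whose non-zero elements are `≼`-equivalent; then (d_ord)) — weak hypothesis.
[cite: MochizukiFrdI2008, Def. 2.4(i) p.47] -/
theorem precsim_of_factorMap_eq_mulSingle (h : IsPerfFactorialWeak M)
    {𝔮 : Primes (Perfection M)} {y₁ p : Perfection M} (hp : p ∈ 𝔮.carrier) (x₁ : PfAt M 𝔮)
    (hy₁ : haveI := Classical.decEq (Primes (Perfection M));
      factorMap M y₁ = pfFactorToRlfFactor M (Pi.mulSingle 𝔮 x₁)) : y₁ ≼ p := by
  classical
  obtain ⟨xp, hxp⟩ := h.factorMap_mem_range p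
  have hw1 : (xp 𝔮 : Perfection M) ≠ 1 := by
    intro hw
    apply h.factorMap_apply_ne_one hp
    rw [← hxp, pfFactorToRlfFactor_apply, show xp 𝔮 = 1 from Subtype.ext hw, map_one]
  obtain ⟨n, hn, c, hc, hxc⟩ :=
    𝔮.exists_mul_eq_pow_of_mem_submonoid (x₁).2 (xp 𝔮).2 hw1
  refine ⟨n, hn, h.dvd_of_factorMap_mul_eq (x := Function.update (xp ^ n) 𝔮 ⟨c, hc⟩) ?_⟩
  rw [show factorMap M (p ^ n) = factorMap M p ^ n from map_pow h.factorHom p n, hy₁, ← map_mul,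
    ← hxp, ← map_pow]
  congr 1
  funext 𝔮'
  rw [Pi.mul_apply, Pi.pow_apply]
  by_cases e : 𝔮' = 𝔮
  · subst e
    rw [Pi.mulSingle_eq_same, Function.update_self]
    exact Subtype.ext hxc
  · rw [Pi.mulSingle_eq_of_ne e, Function.update_of_ne e, one_mul, Pi.pow_apply]

/-- **Def. 2.4 (i)(b)** in use, weak hypothesis: any two elements of `M_𝔭` are comparable for `≤`
("the structure of the `Φ(A)_𝔭`", proof of Prop. 4.1, p. 76). [cite: MochizukiFrdI2008, Def. 2.4(i) p.47] -/
theorem dvd_total_of_mem_submonoid (h : IsPerfFactorialWeak M) (𝔭 : Primes M)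
    {a b : M} (ha : a ∈ 𝔭.submonoid) (hb : b ∈ 𝔭.submonoid) : a ∣ b ∨ b ∣ a := by
  rcases (h.isMonoprime 𝔭).dvd_total ⟨a, ha⟩ ⟨b, hb⟩ with h1 | h1
  · exact Or.inl (by simpa using map_dvd 𝔭.submonoid.subtype h1)
  · exact Or.inr (by simpa using map_dvd 𝔭.submonoid.subtype h1)

/-! ### Helpers on the factorization homomorphism, weak hypothesis -/

/-- `Supp` is monotone for divisibility (weak hypothesis). [cite: MochizukiFrdI2008, Def. 2.4(i) p.48] -/
theorem supp_factorMap_subset_of_dvd (h : IsPerfFactorialWeak M) {a b : Perfection M}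
    (hab : a ∣ b) : supp (factorMap M a) ⊆ supp (factorMap M b) := by
  obtain ⟨c, rfl⟩ := hab
  rw [h.factorMap_mul]
  exact supp_subset_supp_mul _ _

/-- A non-zero element supported at the single prime `𝔮` belongs to `𝔮` (it is `≼ p` for `p ∈ 𝔮`),
weak hypothesis. [cite: MochizukiFrdI2008, Def. 2.4(i) p.47] -/
theorem mem_carrier_of_factorMap_eq_mulSingle (h : IsPerfFactorialWeak M)
    {𝔮 : Primes (Perfection M)} {y₁ : Perfection M} (x₁ : PfAt M 𝔮)
    (hy₁ : haveI := Classical.decEq (Primes (Perfection M));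
      factorMap M y₁ = pfFactorToRlfFactor M (Pi.mulSingle 𝔮 x₁)) (hy1 : y₁ ≠ 1) :
    y₁ ∈ 𝔮.carrier := by
  obtain ⟨⟨p, hp'⟩, hp⟩ := Quotient.exists_rep 𝔮
  have hpc : p ∈ 𝔮.carrier := ⟨hp', hp⟩
  exact 𝔮.mem_carrier_of_precsim hpc hy1 (h.precsim_of_factorMap_eq_mulSingle hpc x₁ hy₁)

/-- Coordinates of a splitting `y = y₁ + y₂` at `𝔮` (as produced by `exists_split`): off `𝔮`, the
coordinates of `y` are those of `y₂` (weak hypothesis). [cite: MochizukiFrdI2008, Def. 2.4(i) p.47] -/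
theorem factorMap_apply_of_split_ne (h : IsPerfFactorialWeak M)
    {𝔮 𝔮' : Primes (Perfection M)} {y y₁ y₂ : Perfection M} (x₁ : PfAt M 𝔮) (hy : y₁ * y₂ = y)
    (hy₁ : haveI := Classical.decEq (Primes (Perfection M));
      factorMap M y₁ = pfFactorToRlfFactor M (Pi.mulSingle 𝔮 x₁)) (hne : 𝔮' ≠ 𝔮) :
    factorMap M y 𝔮' = factorMap M y₂ 𝔮' := by
  classical
  rw [← hy, h.factorMap_mul, Pi.mul_apply, hy₁, pfFactorToRlfFactor_apply, Pi.mulSingle_eq_of_ne hne,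
    map_one, one_mul]

/-- Coordinates of a splitting `y = y₁ + y₂` at `𝔮`: at `𝔮`, the coordinate of `y` is that of `y₁`
(weak hypothesis). [cite: MochizukiFrdI2008, Def. 2.4(i) p.47] -/
theorem factorMap_apply_of_split_same (h : IsPerfFactorialWeak M)
    {𝔮 : Primes (Perfection M)} {y y₁ y₂ : Perfection M} (hy : y₁ * y₂ = y)
    (hy₂ : factorMap M y₂ 𝔮 = 1) : factorMap M y 𝔮 = factorMap M y₁ 𝔮 := by
  rw [← hy, h.factorMap_mul, Pi.mul_apply, hy₂, mul_one]

/-! ### Proposition 4.1 (iii), the monoid statements, weak hypothesis -/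

/-- **Proposition 4.1 (iii) in the language of monoids, for WEAKLY perf-factorial `M`**, the criterion
(FrdI pp. 76–77): in a perfect weakly perf-factorial monoid, "every `x` such that `x ≤ a`, `x ≤ b` is,
in fact, equal to `0`" iff `a`, `b` have disjoint supports ("by considering the primary factorizations
of `x_ε, x_ι`" — the weak splitting (d_res) and (d_ord) suffice). [cite: MochizukiFrdI2008, Prop. 4.1 (iii) p.76] -/
theorem forall_common_dvd_eq_one_iff_disjoint_supp (h : IsPerfFactorialWeak M)
    (hperf : IsPerfect M) (a b : M) :
    (∀ x : M, x ∣ a → x ∣ b → x = 1) ↔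
      Disjoint (supp (factorMap M (Perfection.of M a))) (supp (factorMap M (Perfection.of M b))) := by
  have hM : IsSharp M := h.isDivisorial.isSharp
  have hbij := isPerfect_iff_bijective_of.mp hperf
  rw [Set.disjoint_left]
  constructor
  · intro hno 𝔮 h𝔮a h𝔮b
    obtain ⟨a₁, a₂, xa, ha, ha₁, ha₂⟩ := h.exists_split (Perfection.of M a) 𝔮
    obtain ⟨b₁, b₂, xb, hb, hb₁, hb₂⟩ := h.exists_split (Perfection.of M b) 𝔮
    have ha₁1 : a₁ ≠ 1 := by
      intro e
      apply h𝔮a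
      show factorMap M (Perfection.of M a) 𝔮 = 1
      rw [h.factorMap_apply_of_split_same ha ha₂, e, h.factorMap_one]; rfl
    have hb₁1 : b₁ ≠ 1 := by
      intro e
      apply h𝔮b
      show factorMap M (Perfection.of M b) 𝔮 = 1
      rw [h.factorMap_apply_of_split_same hb hb₂, e, h.factorMap_one]; rfl
    have ha₁c := h.mem_carrier_of_factorMap_eq_mulSingle xa ha₁ ha₁1
    have hb₁c := h.mem_carrier_of_factorMap_eq_mulSingle xb hb₁ hb₁1
    obtain ⟨A₁, rfl⟩ := hbij.2 a₁
    obtain ⟨B₁, rfl⟩ := hbij.2 b₁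
    have hA₁prim : IsPrimary A₁ := (Perfection.isPrimary_of_iff hM).mp ha₁c.1
    have hB₁1 : B₁ ≠ 1 := fun e => hb₁1 (by rw [e, map_one])
    let 𝔭 : Primes M := Quotient.mk (primarySetoid M) ⟨A₁, hA₁prim⟩
    have hA₁𝔭 : A₁ ∈ 𝔭.carrier := mem_carrier_mk_of_isPrimary hA₁prim
    have hB₁𝔭 : B₁ ∈ 𝔭.carrier := 𝔭.mem_carrier_of_precsim hA₁𝔭 hB₁1
      (Perfection.of_precsim_of_iff.mp (𝔮.precsim_of_mem_carrier hb₁c ha₁c))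
    have hA₁a : A₁ ∣ a := (Perfection.of_dvd_of_iff hbij).mp (Dvd.intro _ ha)
    have hB₁b : B₁ ∣ b := (Perfection.of_dvd_of_iff hbij).mp (Dvd.intro _ hb)
    rcases h.dvd_total_of_mem_submonoid 𝔭 (Submonoid.subset_closure hA₁𝔭)
      (Submonoid.subset_closure hB₁𝔭) with h1 | h1
    · exact hA₁prim.1 (hno A₁ hA₁a (h1.trans hB₁b))
    · exact hB₁1 (hno B₁ (h1.trans hA₁a) hB₁b)
  · intro hdis x hxa hxb
    by_contra hx1
    have hx1' : Perfection.of M x ≠ 1 := fun e => hx1 (hbij.1 (by rw [e, map_one]))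
    -- a non-zero element has a non-zero factorization (clause (c): injectivity)
    have hq : ∃ 𝔮 : Primes (Perfection M), factorMap M (Perfection.of M x) 𝔮 ≠ 1 := by
      by_contra hc
      push Not at hc
      exact hx1' (h.factorMap_injective ((funext hc).trans h.factorMap_one.symm))
    obtain ⟨𝔮, h𝔮⟩ := hq
    exact hdis (h.supp_factorMap_subset_of_dvd (map_dvd _ hxa) h𝔮)
      (h.supp_factorMap_subset_of_dvd (map_dvd _ hxb) h𝔮)

/-- **Proposition 4.1 (iii) in the language of monoids, for WEAKLY perf-factorial `M`**, the displayed
property (FrdI p. 77): in a perfect weakly perf-factorial monoid, if no non-zero `x` satisfies `x ≤ a`,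
`x ≤ b`, then "`a + b ≤ c` if and only if `a ≤ c`, `b ≤ c`" (the non-trivial direction; (d_ord)).
[cite: MochizukiFrdI2008, Prop. 4.1 (iii) p.77] -/
theorem mul_dvd_of_forall_common_dvd_eq_one (h : IsPerfFactorialWeak M)
    (hperf : IsPerfect M) {a b c : M} (hno : ∀ x : M, x ∣ a → x ∣ b → x = 1) (hac : a ∣ c)
    (hbc : b ∣ c) : a * b ∣ c := by
  classical
  have hbij := isPerfect_iff_bijective_of.mp hperf
  have hdis := (h.forall_common_dvd_eq_one_iff_disjoint_supp hperf a b).mp hno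
  obtain ⟨ca, rfl⟩ := hac
  obtain ⟨cb, hcb⟩ := hbc
  obtain ⟨xa, hxa⟩ := h.factorMap_mem_range (Perfection.of M ca)
  obtain ⟨xb, hxb⟩ := h.factorMap_mem_range (Perfection.of M cb)
  apply (Perfection.of_dvd_of_iff hbij).mp
  refine h.dvd_of_factorMap_mul_eq
    (x := fun 𝔮 => if factorMap M (Perfection.of M a) 𝔮 = 1 then xb 𝔮 else xa 𝔮) ?_
  funext 𝔮
  rw [Pi.mul_apply, pfFactorToRlfFactor_apply, map_mul, h.factorMap_mul, Pi.mul_apply]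
  by_cases e : factorMap M (Perfection.of M a) 𝔮 = 1
  · rw [if_pos e, e, one_mul, hcb, map_mul, h.factorMap_mul, Pi.mul_apply, ← hxb,
      pfFactorToRlfFactor_apply]
  · have hb1 : factorMap M (Perfection.of M b) 𝔮 = 1 := by
      by_contra hb1
      exact Set.disjoint_left.mp hdis e hb1
    rw [if_neg e, hb1, mul_one, map_mul, h.factorMap_mul, Pi.mul_apply, ← hxa,
      pfFactorToRlfFactor_apply]

/-- **[FrdI] Prop. 4.1 (iii) / [EtTh] Def. 4.1 (i), "[Thus, `Div(s')`, `Div(s'')` are uniquely determined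
by `f`.]", for WEAKLY perf-factorial `M`**: in a perfect weakly perf-factorial monoid, two pairs `(a, b)`,
`(a', b')` with disjoint supports (no non-trivial common divisor) and `a · b' = a' · b` coincide:
`a = a'`, `b = b'` (coordinatewise in `M ≅ M^pf ↪ ∏_𝔮 M^rlf_𝔮`, Def. 2.4 (i)(c), each `M^rlf_𝔮` sharp).
[cite: MochizukiFrdI2008, Prop. 4.1 (iii) p.76] -/
theorem eq_of_mul_eq_mul_of_forall_common_dvd_eq_one (h : IsPerfFactorialWeak M)
    (hperf : IsPerfect M) {a b a' b' : M} (hab : ∀ x : M, x ∣ a → x ∣ b → x = 1)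
    (hab' : ∀ x : M, x ∣ a' → x ∣ b' → x = 1) (e : a * b' = a' * b) : a = a' ∧ b = b' := by
  have hbij := isPerfect_iff_bijective_of.mp hperf
  have hd := (h.forall_common_dvd_eq_one_iff_disjoint_supp hperf a b).mp hab
  have hd' := (h.forall_common_dvd_eq_one_iff_disjoint_supp hperf a' b').mp hab'
  have eF : factorMap M (Perfection.of M a) * factorMap M (Perfection.of M b') =
      factorMap M (Perfection.of M a') * factorMap M (Perfection.of M b) := by
    rw [← h.factorMap_mul, ← h.factorMap_mul, ← map_mul, ← map_mul, e]
  have key : ∀ 𝔮, factorMap M (Perfection.of M a) 𝔮 = factorMap M (Perfection.of M a') 𝔮 ∧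
      factorMap M (Perfection.of M b) 𝔮 = factorMap M (Perfection.of M b') 𝔮 := by
    intro 𝔮
    have e𝔮 := congrFun eF 𝔮
    rw [Pi.mul_apply, Pi.mul_apply] at e𝔮
    have h1 : factorMap M (Perfection.of M a) 𝔮 = 1 ∨ factorMap M (Perfection.of M b) 𝔮 = 1 := by
      by_cases hx : factorMap M (Perfection.of M a) 𝔮 = 1
      · exact Or.inl hx
      · exact Or.inr (of_not_not (Set.disjoint_left.mp hd hx))
    have h2 : factorMap M (Perfection.of M a') 𝔮 = 1 ∨ factorMap M (Perfection.of M b') 𝔮 = 1 := by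
      by_cases hx : factorMap M (Perfection.of M a') 𝔮 = 1
      · exact Or.inl hx
      · exact Or.inr (of_not_not (Set.disjoint_left.mp hd' hx))
    exact eq_and_eq_of_mul_eq_mul_of_sharp (isSharp_realification _) h1 h2 e𝔮
  have ha : factorMap M (Perfection.of M a) = factorMap M (Perfection.of M a') :=
    funext fun 𝔮 => (key 𝔮).1
  have hb : factorMap M (Perfection.of M b) = factorMap M (Perfection.of M b') :=
    funext fun 𝔮 => (key 𝔮).2
  exact ⟨hbij.1 (h.factorMap_injective ha), hbij.1 (h.factorMap_injective hb)⟩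

end IsPerfFactorialWeak

/-- The strong statement is the case of the weak one (`IsPerfFactorial.weak`): sanity check that the
port does not change the shape. [cite: MochizukiFrdI2008, Prop. 4.1 (iii) p.76] -/
example (h : IsPerfFactorial M) (hperf : IsPerfect M) {a b a' b' : M}
    (hab : ∀ x : M, x ∣ a → x ∣ b → x = 1) (hab' : ∀ x : M, x ∣ a' → x ∣ b' → x = 1)
    (e : a * b' = a' * b) : a = a' ∧ b = b' :=
  h.weak.eq_of_mul_eq_mul_of_forall_common_dvd_eq_one hperf hab hab' e

end Literature.AlgebraicGeometry.Frobenioids
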